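import Mathlib
import HarnessLib
import Summits.Langlands.Langlands.Theses.SenNullAlignment
import Literature.NumberTheory.Automorphic.HarishChandraFinitenessGL
import Literature.NumberTheory.Automorphic.LocalComponentBJExistsProofs

/-!
# Birth skeleton (BC3) for crux stmt-Langlands-16359
`Summit.Langlands.Langlands.Theses.SenNullAlignment.NonAlignedAtEll` — line `birth`

Route `route-Langlands-SenNullAlignment` (rank-3 crux, "the hardest residue").  The crux: for `K`
totally real, `RD` reciprocity data serving the REGULAR Hilbert case, `π` cuspidal on `GL₂(𝔸_K)`,
L-algebraic, holomorphic of weight `(k, w)` with totally odd central sign and some `k_β = 1`, `ℓ`, `ι`,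
`ρ : Γ_K → GL₂(ℚ̄_ℓ)` irreducible and Satake–Frobenius compatible with `π` at almost all places, and a
place `v ∣ ℓ` that is NOT fully aligned (some `ℓ`-adic embedding above `v` reads a weight `k ≠ 1`):
`LocalGlobalCompatibleAt RD ι π ρ v` AND `ρ|Γ_{K_v}` is de Rham for Fontaine's pinned datum
`RD.pst ℓ v hv`.

The skeleton cuts the crux along the seams that every proved case of local–global compatibility at
`p` for Hilbert modular forms respects (Saito, Kisin, Skinner, Liu, Boxer–Pilloni; Newton for partial
weight one away from `p`), and that the crux's own docstring names ("after Sen-nullity at the singular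
`τ` and Ding's automatic `τ`-de Rhamness at the regular `τ` it is Kisin-type period matching plus ONE
monodromy statement"):

1. **`p`-adic Hodge theory of `ρ|Γ_{K_v}` first, Weil–Deligne matching second** — Buzzard–Gee
   Conj. 3.2.2's two clauses at `v ∣ p`.  `stub_deRhamNonAligned` is the de Rham half (the route's
   lever at a non-aligned place: Sen NULLITY / semisimplicity at the singular embeddings `τ`
   (`k_τ = 1`, coincident Hodge–Tate weights; tree carriers `FramedGaloisRep.IsSenNullAt`,
   `IsHodgeTateAt`, `senWeightsAt` of `PAdicHodge/SenOperator`) plus Ding's partial de Rhamness at the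
   regular embeddings, weights differing by `k_τ − 1 ≥ 1`).  Only for a de Rham `ρ|Γ_{K_v}` does the
   pinned datum attach a Weil–Deligne representation at all
   (`PstWeilDeligneData.IsDeRhamFramed.exists_isWeilDeligneOf`), so the four matching stubs take de
   Rhamness as a hypothesis: the line is `deRham → matching-by-local-type → NonAlignedAtEll`, the route
   header's foreseen "PartialDeRhamAtSingular → SpecialMonodromy → NonAlignedAtEll" with the non-special
   matching made explicit.
2. **The type of the local component `π_v`**, read on the GALOIS side of the local Langlands
   correspondence so that no automorphic definition is needed: for a Frobenius-semisimple
   representative `r₀` of the class `rec_v(π_v) = (RD.llc v).recGL 2 [π_v]` (a Weil–Deligne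
   representation on `ℂ²`), `π_v` is SPECIAL (`St ⊗ χ`; equivalently the tree's `IsSpecialAt`, given
   `rec(St ⊗ χ) = Sp(2) ⊗ χ`, JL Thm 3.3 + Harris–Taylor, not vendored) iff `N(r₀) ≠ 0`, SUPERCUSPIDAL
   iff `r₀` is irreducible (then `N = 0`), and a PRINCIPAL SERIES (or a non-generic character twist of
   `1 ∘ det`, never a local component of a cuspidal `π`, so that sub-case is vacuous) iff `N(r₀) = 0`
   and `r₀` is reducible.  The cases are different theorems in print and in prospect:
   * `stub_principalSeriesCompatible` — potentially crystabelline period matching on the Hilbert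
     eigenvariety (Kisin 2003; Boxer–Pilloni 2021 Thm 23 (4) = Thm 351 (4) proves it for a REGULAR
     (`ℓ`-distinguished) principal series `π_v` and weakly regular odd `π`, conditional on Mok; the
     non-distinguished principal series is open);
   * `stub_supercuspidalCompatible` — the supercuspidal place: in every proved case reduced to the
     principal-series case over solvable totally real extensions `L/K` in which `BC(π)` becomes a
     principal series above `v` (Langlands base change for `GL₂`; Jarvis's `ρ` is compatible with base
     change by Chebotarev + Brauer–Nesbitt), the Weil–Deligne representation being recovered from its
     restrictions by Brauer induction (Saito/Skinner/BLGGT pattern); `ℓ = 2` exceptional (`A₄`/`S₄`)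
     supercuspidals need an iterated cyclic base change first;
   * the SPECIAL place, cut once more into its two printed halves:
     `stub_specialMonodromy` — THE MONODROMY STATEMENT, Newton 2015 §1.1's "seems to require a new
     idea": `π_v` special at a non-aligned `v ∣ ℓ` forces `N ≠ 0` on EVERY Weil–Deligne representation
     the pinned `D_pst` attaches to `ρ|Γ_{K_v}` (all isomorphic, `PstWeilDeligneData.isEquivalent`), for
     a congruence-built `ρ` for which purity is unavailable — Moy–Specter's only printed
     partial-weight-one examples (weight `[5,1]` over `ℚ(√5)`, Steinberg at the INERT prime `2`) live
     exactly here; and `stub_specialCompatible` — GIVEN `N ≠ 0`, the matching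
     `ι WD(ρ|Γ_{K_v})^{F-ss} ≅ rec_v(St ⊗ χ)`: a rank-two Weil–Deligne representation with `N ≠ 0` is
     `(χ'‖·‖^{1/2} ⊕ χ'‖·‖^{-1/2}, N)` for ONE character `χ'` (the line `ker N`), so what is left is
     `χ' ∘ Art = χ` through `ι` — determinant/central character plus the `U_v`-eigenvalue =
     semistable-Frobenius period at the (finite-slope, Iwahori-level) special point of the Hilbert
     eigenvariety (Kisin-type period matching).
* `NonAlignedAtEll_of` — **the composition, kernel-checked, no `sorry`:** fix the crux's context; de
  Rhamness from stub 1; a local component `π_v` exists by Flath's theorem, PROVED in the tree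
  (`AutomorphicRepData.exists_hasLocalComponentAt_of_isAdmissible` from
  `automorphicRep_isAdmissible_holds`, Borel–Jacquet 4.5 + Harish-Chandra finiteness); take the
  representative `r₀ := (rec_v(π_v)).out` (`Quotient.out_eq`) and split on `N(r₀) = 0` and on
  `r₀.IsIrreducible`; the special branch feeds `stub_specialMonodromy`'s `N ≠ 0` into
  `stub_specialCompatible`.  Concludes the route decl BY NAME.

Honest reading of the cut: no stub is bookkeeping — stub 1 is the Sen-theoretic heart of the route at
non-aligned places (open), stub 4 is the printed open problem in its sharpest form (`N_Gal ≠ 0`),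
stub 3 is open as stated (a known reduction pattern, not a known theorem, for partial weight one),
stubs 2 and 5 are the ones nearest to print (BP Thm 23 (4)-type periods; formally XL).  No stub
implies the crux on its own (each matching stub needs de Rhamness and the other local types; the de
Rham stub has no Weil–Deligne content; the monodromy stub has no matching content), none is an
instance refuted by a landed Negative lemma (there is none), none restates the summit.  The trichotomy
is stated through `rec_v`, i.e. it presupposes nothing about `π_v` beyond the tree's
`LocalLanglandsDatum`, and over a representative `r₀` (no choice function in the statements).

Disproof used: none on file for this crux (`ledger crux ls stmt-Langlands-16359`: no workfiles, no
`Disproof.lean`, no `Negative/` lemmas, no crux ideas, 2026-08-17); negatives index of the summit: one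
unrelated entry (K3KugaSatakeDescent anchor, stmt-Langlands-3797).

Shape (for `ledger skeleton check`): stubs `theorem stub_<name> : <signature> := by sorry` stated over
tree declarations only (the crux's own context verbatim, then `ReciprocityData.pst/.llc`,
`PstWeilDeligneData.IsDeRhamFramed/.IsWeilDeligneOf`, `FramedGaloisRep.toLocal`, `SmoothIrrep`,
`IrrClass.mk`, `LocalLanglandsDatum.recGL`, `frobSemisimpleWDSetoid`,
`WeilDeligneRep.N/.IsIrreducible/.IsFrobSemisimple`, `AutomorphicRepData.HasLocalComponentAt`,
`Summit.Langlands.LocalGlobalCompatibleAt`); `_Goal.stub_<name> : Prop := type_of% @stub_<name>` names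
each statement; the composition `NonAlignedAtEll_of (hD : _Goal.stub_deRhamNonAligned)
(hPS : _Goal.stub_principalSeriesCompatible) (hSC : _Goal.stub_supercuspidalCompatible)
(hN : _Goal.stub_specialMonodromy) (hSt : _Goal.stub_specialCompatible) : NonAlignedAtEll` is proved
without `sorry` (axioms `propext, Classical.choice, Quot.sound`).
-/

set_option linter.dupNamespace false
set_option linter.unusedVariables false

noncomputable section

namespace Summit.Langlands.Langlands.Cruxes.NonAlignedAtEll.Birth

-- `Classical`: the place subtypes indexing `mixedSpace K` are `Fintype` classically (`NormedCommRing (mixedSpace K)`,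
-- `DecidableEq (InfinitePlace K)` for `MonoidHom.mulSingle`), exactly as in the route file's `open scoped … Classical …`.
open scoped BigOperators Topology Matrix Classical
open Filter Set Function
open Summit.Langlands.Langlands.Theses.SenNullAlignment

/-! ## 1. The five stubs -/

/-- **STUB 1 — de Rham at a non-aligned place above `ℓ` (the `p`-adic Hodge theory of the singular
embeddings).**  In the crux's context (K totally real; `RD` serving the regular case; `π` cuspidal,
L-algebraic, holomorphic of weight `(k, w)`, totally odd, some `k_β = 1`; `ℓ`, `ι`; `ρ` irreducible and
Satake–Frobenius compatible with `π` almost everywhere; `v ∣ ℓ` NOT fully aligned): `ρ|Γ_{K_v}` is de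
Rham for Fontaine's pinned datum `RD.pst ℓ v hv`.  Intended proof (the route's lever at a non-aligned
place): the Sen weights of `ρ|Γ_{K_v}` at `τ ∣ v` are `{(k_τ − 1 − w)/2, (1 − k_τ − w)/2}` up to the
normalising sign (Boxer–Pilloni Thm 23 (3)), COINCIDENT at the singular `τ` (`k_τ = 1`; `w` is even by
L-algebraicity) and distinct (gap `k_τ − 1`) at the regular `τ`; (a) `τ`-Hodge–Tate NULLITY —
`Θ_τ = (−w/2)·id`, Sen semisimplicity, tree carrier `FramedGaloisRep.IsHodgeTateAt v alg τ` with
`(senWeightsAt v alg τ).Subsingleton` — at the singular `τ` from geometric Sen theory on the Hilbert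
modular variety; (b) a `τ`-Hodge–Tate representation with ONE `τ`-weight is `τ`-de Rham (Tate:
`H¹(Γ_{K_v}, ℂ_p(j)) = 0` for `j ≠ 0`, dévissage along `B_dR⁺/t^n`); (c) `τ`-de Rhamness at the regular
`τ` is automatic for the classical point of the eigenvariety (Ding, partially de Rham families); de
Rham = `τ`-de Rham at every `τ`.  Why it might fail: needs `Θ_τ` SEMISIMPLE at the singular `τ`, not
only the known Sen weights; a classical partial-weight-one `π` whose `ρ` is `τ`-Hodge–Tate-defective at
a singular `τ` of a non-aligned place refutes it (nothing proved forbids it).  Size: open (XL).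
Foreseen split once attacked: `SenSemisimpleAtSingular → DeRhamOfSingularHodgeTate → stub 1`.
[cite: BoxerPilloni2021HigherColeman, Thm 23 (3)] [cite: Ding2014PartiallyDeRham, §0]
[cite: Sen1973, Thm 1] [cite: Berger2002, Thm 0.7] [cite: FontaineAsterisque223VIII, §2.3.7] -/
theorem stub_deRhamNonAligned :
    ∀ (K : Type) [Field K] [NumberField K], NumberField.IsTotallyReal K → ∀ (RD : Summit.Langlands.ReciprocityData K), (∀ (hcpt' : Literature.NumberTheory.Automorphic.isCompact_glFiniteIntegralLevel 2 K) (π' : Literature.NumberTheory.Automorphic.CuspidalAutomorphicRepData 2 K hcpt'), π'.1.IsLAlgebraic → (∃ T : Literature.NumberTheory.Automorphic.InfinityType K 2, π'.1.HasInfinityType T ∧ T.IsRegular) → ∀ (ℓ' : ℕ) [Fact ℓ'.Prime] (ι' : PadicAlgCl ℓ' ≃+* ℂ), ∃ ρ' : Literature.NumberTheory.GaloisRepresentations.FramedGaloisRep K (PadicAlgCl ℓ') 2, ρ'.toGaloisRep.IsIrreducible ∧ Summit.Langlands.IsGeometricFramed RD ρ' ∧ Summit.Langlands.Corresponds RD ι'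 π'.1 ρ') → ∀ (hcpt : Literature.NumberTheory.Automorphic.isCompact_glFiniteIntegralLevel 2 K) (π : Literature.NumberTheory.Automorphic.CuspidalAutomorphicRepData 2 K hcpt) (k : (K →+* ℂ) → ℕ) (w : ℤ), π.1.IsLAlgebraic → π.1.HasInfinityType (fun β : K →+* ℂ => ({(⟨((k β : ℂ) - 1 - w) / 2, (1 - (k β : ℂ) - w) / 2, (k β : ℤ) - 1, by push_cast; ring⟩ : Literature.NumberTheory.Automorphic.ArchWeight), (⟨((k β : ℂ) - 1 - w) / 2, (1 - (k β : ℂ) - w) / 2, (k β : ℤ) - 1, by push_cast; ring⟩ : Literature.NumberTheory.Automorphic.ArchWeight).swap} : Multiset Literature.NumberTheory.Automorphic.ArchWeight)) → (∀ (u : NumberField.InfinitePlace K), ∀ φ ∈ π.1.W, Literature.NumberTheory.Automorphic.rightTranslation (Literature.NumberTheory.Automorphic.AdelicGroupData.gl 2 K) (Matrix.GeneralLinearGroup.scalar (Fin 2) (Units.map (MonoidHom.inl (NumberField.InfiniteAdeleRing K) (IsDedekindDomain.FiniteAdeleRing (NumberField.RingOfIntegers K) K) : NumberField.InfiniteAdeleRing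 K →* NumberField.AdeleRing (NumberField.RingOfIntegers K) K) (Units.map (MonoidHom.mulSingle (fun u' : NumberField.InfinitePlace K => u'.Completion) u : u.Completion →* NumberField.InfiniteAdeleRing K) (-1)))) φ + φ ∈ π.1.W') → (∃ β : K →+* ℂ, k β = 1) → ∀ (ℓ : ℕ) [Fact ℓ.Prime] (ι : PadicAlgCl ℓ ≃+* ℂ) (ρ : Literature.NumberTheory.GaloisRepresentations.FramedGaloisRep K (PadicAlgCl ℓ) 2), ρ.toGaloisRep.IsIrreducible → (∀ᶠ v : IsDedekindDomain.HeightOneSpectrum (NumberField.RingOfIntegers K) in Filter.cofinite, Summit.Langlands.SatakeFrobCompatibleAt ι π.1 ρ v) → ∀ (v : IsDedekindDomain.HeightOneSpectrum (NumberField.RingOfIntegers K)) (hv : ((ℓ : ℕ) : NumberField.RingOfIntegers K) ∈ v.asIdeal), ¬ (∀ τ : K →+* PadicAlgCl ℓ, (∀ x : NumberField.RingOfIntegers K, x ∈ v.asIdeal → ‖τ x‖ < 1) → k ((ι : PadicAlgCl ℓ →+* ℂ).comp τ) = 1) → (RD.pst ℓ v hv).IsDeRhamFramed (ρ.toLocal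 v) := by
  sorry

/-- **STUB 2 — principal-series matching at a non-aligned place (potentially crystabelline periods).**
Same context, PLUS: `ρ|Γ_{K_v}` de Rham (output of stub 1), `π_v` a local component of `π` at `v`
(`HasLocalComponentAt`), `r₀` a Frobenius-semisimple representative of `rec_v(π_v) = (RD.llc v).recGL 2 [π_v]`
with `N(r₀) = 0` and `r₀` REDUCIBLE as a Weil–Deligne representation — i.e. `π_v` is an irreducible
principal series `π(χ₁, χ₂)` (the reducible `N = 0` parameters `χ‖·‖^{±1/2}` belong to the characters
`χ ∘ det`, never local components of a cuspidal `π`: that sub-case is vacuous).  Then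
`LocalGlobalCompatibleAt RD ι π ρ v`: `ι WD(D_pst ρ|Γ_{K_v})^{F-ss} ≅ χ₁ ⊕ χ₂`, in particular `ρ|Γ_{K_v}`
is potentially crystalline (crystabelline).  In print for a REGULAR (`ℓ`-distinguished) principal series
and weakly regular odd `π`: Boxer–Pilloni 2021 Thm 23 (4) (= Thm 351 (4); Kisin-type crystalline periods
in the higher Coleman theory of the Hilbert eigenvariety; conditional on Mok's transfer, their Rem. 24);
Newton 2015 Rem. 5 for unramified `ℓ`-distinguished principal series.  Why it might fail: the
non-distinguished principal series (`χ₁ = χ₂` on a finite-index subgroup: a critical, weight-one-like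
point of the eigenvariety where the period argument degenerates) has no handle in print.  Size: XL.
[cite: BoxerPilloni2021HigherColeman, Thm 23 (4)] [cite: Kisin2003, Thm 6.6]
[cite: Newton2015LowWeight, Rem. 5] [cite: HarrisTaylorAMS2001, Thm. A] -/
theorem stub_principalSeriesCompatible :
    ∀ (K : Type) [Field K] [NumberField K], NumberField.IsTotallyReal K → ∀ (RD : Summit.Langlands.ReciprocityData K), (∀ (hcpt' : Literature.NumberTheory.Automorphic.isCompact_glFiniteIntegralLevel 2 K) (π' : Literature.NumberTheory.Automorphic.CuspidalAutomorphicRepData 2 K hcpt'), π'.1.IsLAlgebraic → (∃ T : Literature.NumberTheory.Automorphic.InfinityType K 2, π'.1.HasInfinityType T ∧ T.IsRegular) → ∀ (ℓ' : ℕ) [Fact ℓ'.Prime] (ι' : PadicAlgCl ℓ' ≃+* ℂ), ∃ ρ' : Literature.NumberTheory.GaloisRepresentations.FramedGaloisRep K (PadicAlgCl ℓ') 2, ρ'.toGaloisRep.IsIrreducible ∧ Summit.Langlands.IsGeometricFramed RD ρ' ∧ Summit.Langlands.Corresponds RD ι' π'.1 ρ') → ∀ (hcpt : Literature.NumberTheory.Automorphic.isCompact_glFiniteIntegralLevel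 2 K) (π : Literature.NumberTheory.Automorphic.CuspidalAutomorphicRepData 2 K hcpt) (k : (K →+* ℂ) → ℕ) (w : ℤ), π.1.IsLAlgebraic → π.1.HasInfinityType (fun β : K →+* ℂ => ({(⟨((k β : ℂ) - 1 - w) / 2, (1 - (k β : ℂ) - w) / 2, (k β : ℤ) - 1, by push_cast; ring⟩ : Literature.NumberTheory.Automorphic.ArchWeight), (⟨((k β : ℂ) - 1 - w) / 2, (1 - (k β : ℂ) - w) / 2, (k β : ℤ) - 1, by push_cast; ring⟩ : Literature.NumberTheory.Automorphic.ArchWeight).swap} : Multiset Literature.NumberTheory.Automorphic.ArchWeight)) → (∀ (u : NumberField.InfinitePlace K), ∀ φ ∈ π.1.W, Literature.NumberTheory.Automorphic.rightTranslation (Literature.NumberTheory.Automorphic.AdelicGroupData.gl 2 K) (Matrix.GeneralLinearGroup.scalar (Fin 2) (Units.map (MonoidHom.inl (NumberField.InfiniteAdeleRing K) (IsDedekindDomain.FiniteAdeleRing (NumberField.RingOfIntegers K) K) : NumberField.InfiniteAdeleRing K →* NumberField.AdeleRing (NumberField.RingOfIntegers K) K) (Units.map (MonoidHom.mulSingle (fun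 u' : NumberField.InfinitePlace K => u'.Completion) u : u.Completion →* NumberField.InfiniteAdeleRing K) (-1)))) φ + φ ∈ π.1.W') → (∃ β : K →+* ℂ, k β = 1) → ∀ (ℓ : ℕ) [Fact ℓ.Prime] (ι : PadicAlgCl ℓ ≃+* ℂ) (ρ : Literature.NumberTheory.GaloisRepresentations.FramedGaloisRep K (PadicAlgCl ℓ) 2), ρ.toGaloisRep.IsIrreducible → (∀ᶠ v : IsDedekindDomain.HeightOneSpectrum (NumberField.RingOfIntegers K) in Filter.cofinite, Summit.Langlands.SatakeFrobCompatibleAt ι π.1 ρ v) → ∀ (v : IsDedekindDomain.HeightOneSpectrum (NumberField.RingOfIntegers K)) (hv : ((ℓ : ℕ) : NumberField.RingOfIntegers K) ∈ v.asIdeal), ¬ (∀ τ : K →+* PadicAlgCl ℓ, (∀ x : NumberField.RingOfIntegers K, x ∈ v.asIdeal → ‖τ x‖ < 1) → k ((ι : PadicAlgCl ℓ →+* ℂ).comp τ) = 1) → (RD.pst ℓ v hv).IsDeRhamFramed (ρ.toLocal v) → ∀ (πv : Literature.NumberTheory.Automorphic.SmoothIrrep (Matrix.GeneralLinearGroup (Fin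 2) (v.adicCompletion K))) (r₀ : {r : Literature.NumberTheory.GaloisRepresentations.WeilDeligneRep (v.adicCompletion K) ℂ (Fin 2 → ℂ) // r.IsFrobSemisimple}), π.1.HasLocalComponentAt v πv.ρ → Quotient.mk (Literature.NumberTheory.Automorphic.frobSemisimpleWDSetoid (v.adicCompletion K) 2) r₀ = (RD.llc v).recGL 2 (Literature.NumberTheory.Automorphic.IrrClass.mk πv) → r₀.1.N = 0 → ¬ r₀.1.IsIrreducible → Summit.Langlands.LocalGlobalCompatibleAt RD ι π.1 ρ v := by
  sorry

/-- **STUB 3 — supercuspidal matching at a non-aligned place (solvable base change + Brauer).**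
Same context, PLUS: `ρ|Γ_{K_v}` de Rham, `π_v` a local component at `v`, `r₀` a Frobenius-semisimple
representative of `rec_v(π_v)` with `N(r₀) = 0` which is IRREDUCIBLE as a Weil–Deligne representation
(`π_v` supercuspidal).  Then `LocalGlobalCompatibleAt RD ι π ρ v`.  Intended proof, the pattern of every
proved case (Saito; Skinner 2009; BLGGT): for non-exceptional `π_v` (induced from a character of a
quadratic `E_w/K_v`) choose solvable totally real `L/K`, `v`-locally containing `E_w`, in which
`BC_{L/K}(π)` — again cuspidal, L-algebraic, holomorphic of partial weight one, totally odd — is a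
principal series above `v`; Jarvis's `ρ` restricts compatibly (Chebotarev + Brauer–Nesbitt); stub 2 over
enough such `L` and Brauer induction on the Weil side recover `WD(ρ|Γ_{K_v})^{F-ss}` (and `N = 0` is
insensitive to finite restriction).  Why it might fail: the reduction re-enters stub 2 over `L` with side
conditions that can fail — cuspidality of `BC_{L/K}(π)` and irreducibility of `ρ|Γ_L` for CM-induced `π`,
and a principal series above `v` that may be NON-distinguished (stub 2's open sub-case); `ℓ = 2`
exceptional (`A₄`/`S₄`) supercuspidals need an iterated cyclic base change before they are induced from a
character (non-alignedness itself is preserved: the weights read above `w ∣ v` in `L` are those read above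
`v`).  Size: L–XL.
[cite: LanglandsBaseChange1980, Ch. 3] [cite: Skinner2009, §2] [cite: HarrisTaylorAMS2001, Thm. A]
[cite: Jarvis1997, Thm 1] -/
theorem stub_supercuspidalCompatible :
    ∀ (K : Type) [Field K] [NumberField K], NumberField.IsTotallyReal K → ∀ (RD : Summit.Langlands.ReciprocityData K), (∀ (hcpt' : Literature.NumberTheory.Automorphic.isCompact_glFiniteIntegralLevel 2 K) (π' : Literature.NumberTheory.Automorphic.CuspidalAutomorphicRepData 2 K hcpt'), π'.1.IsLAlgebraic → (∃ T : Literature.NumberTheory.Automorphic.InfinityType K 2, π'.1.HasInfinityType T ∧ T.IsRegular) → ∀ (ℓ' : ℕ) [Fact ℓ'.Prime] (ι' : PadicAlgCl ℓ' ≃+* ℂ), ∃ ρ' : Literature.NumberTheory.GaloisRepresentations.FramedGaloisRep K (PadicAlgCl ℓ') 2, ρ'.toGaloisRep.IsIrreducible ∧ Summit.Langlands.IsGeometricFramed RD ρ' ∧ Summit.Langlands.Corresponds RD ι' π'.1 ρ') → ∀ (hcpt : Literature.NumberTheory.Automorphic.isCompact_glFiniteIntegralLevel 2 K) (π : Literature.NumberTheory.Automorphic.CuspidalAutomorphicRepData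 2 K hcpt) (k : (K →+* ℂ) → ℕ) (w : ℤ), π.1.IsLAlgebraic → π.1.HasInfinityType (fun β : K →+* ℂ => ({(⟨((k β : ℂ) - 1 - w) / 2, (1 - (k β : ℂ) - w) / 2, (k β : ℤ) - 1, by push_cast; ring⟩ : Literature.NumberTheory.Automorphic.ArchWeight), (⟨((k β : ℂ) - 1 - w) / 2, (1 - (k β : ℂ) - w) / 2, (k β : ℤ) - 1, by push_cast; ring⟩ : Literature.NumberTheory.Automorphic.ArchWeight).swap} : Multiset Literature.NumberTheory.Automorphic.ArchWeight)) → (∀ (u : NumberField.InfinitePlace K), ∀ φ ∈ π.1.W, Literature.NumberTheory.Automorphic.rightTranslation (Literature.NumberTheory.Automorphic.AdelicGroupData.gl 2 K) (Matrix.GeneralLinearGroup.scalar (Fin 2) (Units.map (MonoidHom.inl (NumberField.InfiniteAdeleRing K) (IsDedekindDomain.FiniteAdeleRing (NumberField.RingOfIntegers K) K) : NumberField.InfiniteAdeleRing K →* NumberField.AdeleRing (NumberField.RingOfIntegers K) K) (Units.map (MonoidHom.mulSingle (fun u' : NumberField.InfinitePlace K => u'.Completion) u : u.Completion →* NumberField.InfiniteAdeleRing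 K) (-1)))) φ + φ ∈ π.1.W') → (∃ β : K →+* ℂ, k β = 1) → ∀ (ℓ : ℕ) [Fact ℓ.Prime] (ι : PadicAlgCl ℓ ≃+* ℂ) (ρ : Literature.NumberTheory.GaloisRepresentations.FramedGaloisRep K (PadicAlgCl ℓ) 2), ρ.toGaloisRep.IsIrreducible → (∀ᶠ v : IsDedekindDomain.HeightOneSpectrum (NumberField.RingOfIntegers K) in Filter.cofinite, Summit.Langlands.SatakeFrobCompatibleAt ι π.1 ρ v) → ∀ (v : IsDedekindDomain.HeightOneSpectrum (NumberField.RingOfIntegers K)) (hv : ((ℓ : ℕ) : NumberField.RingOfIntegers K) ∈ v.asIdeal), ¬ (∀ τ : K →+* PadicAlgCl ℓ, (∀ x : NumberField.RingOfIntegers K, x ∈ v.asIdeal → ‖τ x‖ < 1) → k ((ι : PadicAlgCl ℓ →+* ℂ).comp τ) = 1) → (RD.pst ℓ v hv).IsDeRhamFramed (ρ.toLocal v) → ∀ (πv : Literature.NumberTheory.Automorphic.SmoothIrrep (Matrix.GeneralLinearGroup (Fin 2) (v.adicCompletion K))) (r₀ : {r : Literature.NumberTheory.GaloisRepresentations.WeilDeligneRep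 (v.adicCompletion K) ℂ (Fin 2 → ℂ) // r.IsFrobSemisimple}), π.1.HasLocalComponentAt v πv.ρ → Quotient.mk (Literature.NumberTheory.Automorphic.frobSemisimpleWDSetoid (v.adicCompletion K) 2) r₀ = (RD.llc v).recGL 2 (Literature.NumberTheory.Automorphic.IrrClass.mk πv) → r₀.1.N = 0 → r₀.1.IsIrreducible → Summit.Langlands.LocalGlobalCompatibleAt RD ι π.1 ρ v := by
  sorry

/-- **STUB 4 — THE MONODROMY STATEMENT: `N ≠ 0` for `ρ|Γ_{K_v}` at a special non-aligned place.**
Same context, PLUS: `ρ|Γ_{K_v}` de Rham, `π_v` a local component at `v`, `r₀` a Frobenius-semisimple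
representative of `rec_v(π_v)` with `N(r₀) ≠ 0` — i.e. `π_v ≅ St ⊗ χ` is SPECIAL.  Then EVERY
Weil–Deligne representation `r` that Fontaine's pinned datum attaches to `ρ|Γ_{K_v}`
(`(RD.pst ℓ v hv).IsWeilDeligneOf (ρ.toLocal v) r`; they exist by de Rhamness and are pairwise
isomorphic, `PstWeilDeligneData.exists_of_isDeRham` / `.isEquivalent`) has `r.N ≠ 0`: the
congruence-built `ρ` is semistable NON-crystalline at `v` up to a finite twist.  This is Newton 2015
§1.1's excluded case verbatim ("the case where `π` is special at places dividing `p` seems to require a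
new idea": for the `p`-adic member of the compatible system, level-lowering + Kassaei gluing has no
classicality theorem, and purity — which gives `N ≠ 0` for regular weights via the weight–monodromy
argument of Saito/Skinner — is unavailable for congruence-built `ρ`) and the home of the only printed
non-CM partial-weight-one examples (Moy–Specter 2015: weight `[5,1]` over `ℚ(√5)`, level `Γ₀(14)`,
Steinberg up to unramified quadratic twist at the INERT prime `2` — non-alignable, as the route
predicts; weak admissibility allows `N ≠ 0` there: `Σ_{τ∣2}(k_τ − 1) = 4 ≥ f = 2`).  Intended attack: with
stub 1, `D_st` of the finite twist of `ρ|Γ_{K_v}` is a rank-two filtered `(φ, N)`-module whose Frobenius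
is pinned by the `U_v`-eigenvalue (the special point of the Hilbert eigenvariety has finite slope and
Iwahori level: Kisin-type semistable period); `N = 0` would make it crystalline with Frobenius
eigenvalues of ratio `q_v` — NOT excluded by weak admissibility alone (the Hodge polygon of the
non-aligned labelled weights `{(w − k_τ + 1)/2, (w + k_τ − 1)/2}_τ` leaves room), so excluding it is a
genuinely new statement: an `𝓛`-invariant / critical companion-point exclusion on the partially de Rham
eigenvariety (Ding 2015), or an `R = T` / local deformation argument at the Steinberg component (which
would engage the patching barriers the route otherwise avoids).  Why it might fail:
nothing in print forces `N ≠ 0`; a genuinely crystalline `ρ|Γ_{K_v}` with Steinberg-type Frobenius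
eigenvalues at a partial-weight-one point is excluded by no known classicality theorem.
Size: OPEN PROBLEM (the crux's core).
[cite: Newton2015LowWeight, §1.1 and Rem. 5] [cite: MoySpecter2015, Rem. 1.1]
[cite: Ding2015LinvariantsPartiallyDeRham, Thm 1.1] [cite: Skinner2009, §3] [cite: Kisin2003, Thm 6.6] -/
theorem stub_specialMonodromy :
    ∀ (K : Type) [Field K] [NumberField K], NumberField.IsTotallyReal K → ∀ (RD : Summit.Langlands.ReciprocityData K), (∀ (hcpt' : Literature.NumberTheory.Automorphic.isCompact_glFiniteIntegralLevel 2 K) (π' : Literature.NumberTheory.Automorphic.CuspidalAutomorphicRepData 2 K hcpt'), π'.1.IsLAlgebraic → (∃ T : Literature.NumberTheory.Automorphic.InfinityType K 2, π'.1.HasInfinityType T ∧ T.IsRegular) → ∀ (ℓ' : ℕ) [Fact ℓ'.Prime] (ι' : PadicAlgCl ℓ' ≃+* ℂ), ∃ ρ' : Literature.NumberTheory.GaloisRepresentations.FramedGaloisRep K (PadicAlgCl ℓ') 2, ρ'.toGaloisRep.IsIrreducible ∧ Summit.Langlands.IsGeometricFramed RD ρ' ∧ Summit.Langlands.Corresponds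 RD ι' π'.1 ρ') → ∀ (hcpt : Literature.NumberTheory.Automorphic.isCompact_glFiniteIntegralLevel 2 K) (π : Literature.NumberTheory.Automorphic.CuspidalAutomorphicRepData 2 K hcpt) (k : (K →+* ℂ) → ℕ) (w : ℤ), π.1.IsLAlgebraic → π.1.HasInfinityType (fun β : K →+* ℂ => ({(⟨((k β : ℂ) - 1 - w) / 2, (1 - (k β : ℂ) - w) / 2, (k β : ℤ) - 1, by push_cast; ring⟩ : Literature.NumberTheory.Automorphic.ArchWeight), (⟨((k β : ℂ) - 1 - w) / 2, (1 - (k β : ℂ) - w) / 2, (k β : ℤ) - 1, by push_cast; ring⟩ : Literature.NumberTheory.Automorphic.ArchWeight).swap} : Multiset Literature.NumberTheory.Automorphic.ArchWeight)) → (∀ (u : NumberField.InfinitePlace K), ∀ φ ∈ π.1.W, Literature.NumberTheory.Automorphic.rightTranslation (Literature.NumberTheory.Automorphic.AdelicGroupData.gl 2 K) (Matrix.GeneralLinearGroup.scalar (Fin 2) (Units.map (MonoidHom.inl (NumberField.InfiniteAdeleRing K) (IsDedekindDomain.FiniteAdeleRing (NumberField.RingOfIntegers K) K) : NumberField.InfiniteAdeleRing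 K →* NumberField.AdeleRing (NumberField.RingOfIntegers K) K) (Units.map (MonoidHom.mulSingle (fun u' : NumberField.InfinitePlace K => u'.Completion) u : u.Completion →* NumberField.InfiniteAdeleRing K) (-1)))) φ + φ ∈ π.1.W') → (∃ β : K →+* ℂ, k β = 1) → ∀ (ℓ : ℕ) [Fact ℓ.Prime] (ι : PadicAlgCl ℓ ≃+* ℂ) (ρ : Literature.NumberTheory.GaloisRepresentations.FramedGaloisRep K (PadicAlgCl ℓ) 2), ρ.toGaloisRep.IsIrreducible → (∀ᶠ v : IsDedekindDomain.HeightOneSpectrum (NumberField.RingOfIntegers K) in Filter.cofinite, Summit.Langlands.SatakeFrobCompatibleAt ι π.1 ρ v) → ∀ (v : IsDedekindDomain.HeightOneSpectrum (NumberField.RingOfIntegers K)) (hv : ((ℓ : ℕ) : NumberField.RingOfIntegers K) ∈ v.asIdeal), ¬ (∀ τ : K →+* PadicAlgCl ℓ, (∀ x : NumberField.RingOfIntegers K, x ∈ v.asIdeal → ‖τ x‖ < 1) → k ((ι : PadicAlgCl ℓ →+* ℂ).comp τ) = 1) → (RD.pst ℓ v hv).IsDeRhamFramed (ρ.toLocal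 v) → ∀ (πv : Literature.NumberTheory.Automorphic.SmoothIrrep (Matrix.GeneralLinearGroup (Fin 2) (v.adicCompletion K))) (r₀ : {r : Literature.NumberTheory.GaloisRepresentations.WeilDeligneRep (v.adicCompletion K) ℂ (Fin 2 → ℂ) // r.IsFrobSemisimple}), π.1.HasLocalComponentAt v πv.ρ → Quotient.mk (Literature.NumberTheory.Automorphic.frobSemisimpleWDSetoid (v.adicCompletion K) 2) r₀ = (RD.llc v).recGL 2 (Literature.NumberTheory.Automorphic.IrrClass.mk πv) → r₀.1.N ≠ 0 → (∀ r : Literature.NumberTheory.GaloisRepresentations.WeilDeligneRep (v.adicCompletion K) (PadicAlgCl ℓ) (Fin 2 → PadicAlgCl ℓ), (RD.pst ℓ v hv).IsWeilDeligneOf (ρ.toLocal v) r → r.N ≠ 0) := by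
  sorry

/-- **STUB 5 — special matching GIVEN the monodromy (Kisin-type period at the special point).**
Same context, PLUS: `ρ|Γ_{K_v}` de Rham, `π_v` a local component at `v`, `r₀` a Frobenius-semisimple
representative of `rec_v(π_v)` with `N(r₀) ≠ 0` (`π_v ≅ St ⊗ χ` special), AND the output of stub 4: every
Weil–Deligne representation attached to `ρ|Γ_{K_v}` by the pinned datum has `N ≠ 0`.  Then
`LocalGlobalCompatibleAt RD ι π ρ v`, i.e. `ι WD(D_pst ρ|Γ_{K_v})^{F-ss} ≅ (χ‖·‖^{1/2} ⊕ χ‖·‖^{-1/2}, N ≠ 0)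
= rec_v(St ⊗ χ)`.  Content: a rank-two Weil–Deligne representation with `N ≠ 0` is
`(χ'‖·‖^{1/2} ⊕ χ'‖·‖^{-1/2}, N)` for the character `χ'` of `W_{K_v}` on the line `ker N`
(the Weil–Deligne relation `ρ(w) N ρ(w)⁻¹ = ‖w‖ N`), and its Frobenius-semisimplification keeps `N` and
`χ'`; so the statement is `ι ∘ χ' ∘ Art_v⁻¹ = χ`: the determinant (central character of `π` times the
cyclotomic bookkeeping of the L-normalisation, read off the Satake clause at the unramified places by
Chebotarev) fixes `χ'²`, and the `U_v`-eigenvalue of the Iwahori-level special vector equals the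
semistable Frobenius eigenvalue on `D_st` (Kisin's period argument at a finite-slope classical point of
the Hilbert eigenvariety; Boxer–Pilloni's higher Coleman theory supplies the point for partial weight
one), which fixes `χ'(ϖ_v)`; the ramified part of `χ'` is read after a finite abelian base change
killing `χ|_{𝒪ᵛˣ}`.  Why it might fail: the period argument at `p` for a special (hence
non-`ℓ`-distinguished-principal-series) component of a partial-weight-one form is not in print
(Boxer–Pilloni Thm 23 (4) assumes a regular principal series), and for ramified `χ` the abelian base
change must keep the place non-aligned and the form inside the route's universe.  Size: L–XL.
[cite: Kisin2003, Thm 6.6] [cite: BoxerPilloni2021HigherColeman, Thm 23 (4)] [cite: TateCorvallis1979, (4.1.3)–(4.2.1)]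
[cite: HarrisTaylorAMS2001, Thm. A] [cite: Skinner2009, §3] -/
theorem stub_specialCompatible :
    ∀ (K : Type) [Field K] [NumberField K], NumberField.IsTotallyReal K → ∀ (RD : Summit.Langlands.ReciprocityData K), (∀ (hcpt' : Literature.NumberTheory.Automorphic.isCompact_glFiniteIntegralLevel 2 K) (π' : Literature.NumberTheory.Automorphic.CuspidalAutomorphicRepData 2 K hcpt'), π'.1.IsLAlgebraic → (∃ T : Literature.NumberTheory.Automorphic.InfinityType K 2, π'.1.HasInfinityType T ∧ T.IsRegular) → ∀ (ℓ' : ℕ) [Fact ℓ'.Prime] (ι' : PadicAlgCl ℓ' ≃+* ℂ), ∃ ρ' : Literature.NumberTheory.GaloisRepresentations.FramedGaloisRep K (PadicAlgCl ℓ') 2, ρ'.toGaloisRep.IsIrreducible ∧ Summit.Langlands.IsGeometricFramed RD ρ' ∧ Summit.Langlands.Corresponds RD ι' π'.1 ρ') → ∀ (hcpt : Literature.NumberTheory.Automorphic.isCompact_glFiniteIntegralLevel 2 K) (π : Literature.NumberTheory.Automorphic.CuspidalAutomorphicRepData 2 K hcpt) (k : (K →+* ℂ) → ℕ) (w : ℤ),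 π.1.IsLAlgebraic → π.1.HasInfinityType (fun β : K →+* ℂ => ({(⟨((k β : ℂ) - 1 - w) / 2, (1 - (k β : ℂ) - w) / 2, (k β : ℤ) - 1, by push_cast; ring⟩ : Literature.NumberTheory.Automorphic.ArchWeight), (⟨((k β : ℂ) - 1 - w) / 2, (1 - (k β : ℂ) - w) / 2, (k β : ℤ) - 1, by push_cast; ring⟩ : Literature.NumberTheory.Automorphic.ArchWeight).swap} : Multiset Literature.NumberTheory.Automorphic.ArchWeight)) → (∀ (u : NumberField.InfinitePlace K), ∀ φ ∈ π.1.W, Literature.NumberTheory.Automorphic.rightTranslation (Literature.NumberTheory.Automorphic.AdelicGroupData.gl 2 K) (Matrix.GeneralLinearGroup.scalar (Fin 2) (Units.map (MonoidHom.inl (NumberField.InfiniteAdeleRing K) (IsDedekindDomain.FiniteAdeleRing (NumberField.RingOfIntegers K) K) : NumberField.InfiniteAdeleRing K →* NumberField.AdeleRing (NumberField.RingOfIntegers K) K) (Units.map (MonoidHom.mulSingle (fun u' : NumberField.InfinitePlace K => u'.Completion) u : u.Completion →* NumberField.InfiniteAdeleRing K) (-1)))) φ + φ ∈ π.1.W')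 → (∃ β : K →+* ℂ, k β = 1) → ∀ (ℓ : ℕ) [Fact ℓ.Prime] (ι : PadicAlgCl ℓ ≃+* ℂ) (ρ : Literature.NumberTheory.GaloisRepresentations.FramedGaloisRep K (PadicAlgCl ℓ) 2), ρ.toGaloisRep.IsIrreducible → (∀ᶠ v : IsDedekindDomain.HeightOneSpectrum (NumberField.RingOfIntegers K) in Filter.cofinite, Summit.Langlands.SatakeFrobCompatibleAt ι π.1 ρ v) → ∀ (v : IsDedekindDomain.HeightOneSpectrum (NumberField.RingOfIntegers K)) (hv : ((ℓ : ℕ) : NumberField.RingOfIntegers K) ∈ v.asIdeal), ¬ (∀ τ : K →+* PadicAlgCl ℓ, (∀ x : NumberField.RingOfIntegers K, x ∈ v.asIdeal → ‖τ x‖ < 1) → k ((ι : PadicAlgCl ℓ →+* ℂ).comp τ) = 1) → (RD.pst ℓ v hv).IsDeRhamFramed (ρ.toLocal v) → ∀ (πv : Literature.NumberTheory.Automorphic.SmoothIrrep (Matrix.GeneralLinearGroup (Fin 2) (v.adicCompletion K))) (r₀ : {r : Literature.NumberTheory.GaloisRepresentations.WeilDeligneRep (v.adicCompletion K) ℂ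 (Fin 2 → ℂ) // r.IsFrobSemisimple}), π.1.HasLocalComponentAt v πv.ρ → Quotient.mk (Literature.NumberTheory.Automorphic.frobSemisimpleWDSetoid (v.adicCompletion K) 2) r₀ = (RD.llc v).recGL 2 (Literature.NumberTheory.Automorphic.IrrClass.mk πv) → r₀.1.N ≠ 0 → (∀ r : Literature.NumberTheory.GaloisRepresentations.WeilDeligneRep (v.adicCompletion K) (PadicAlgCl ℓ) (Fin 2 → PadicAlgCl ℓ), (RD.pst ℓ v hv).IsWeilDeligneOf (ρ.toLocal v) r → r.N ≠ 0) → Summit.Langlands.LocalGlobalCompatibleAt RD ι π.1 ρ v := by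
  sorry

/-! ## 2. The stub statements as named `Prop`s (literally their types) -/

namespace _Goal

/-- The statement of `stub_deRhamNonAligned`, as a named `Prop` (literally its type). [folklore] -/
def stub_deRhamNonAligned : Prop :=
  type_of% @Summit.Langlands.Langlands.Cruxes.NonAlignedAtEll.Birth.stub_deRhamNonAligned

/-- The statement of `stub_principalSeriesCompatible`, as a named `Prop` (literally its type). [folklore] -/
def stub_principalSeriesCompatible : Prop :=
  type_of% @Summit.Langlands.Langlands.Cruxes.NonAlignedAtEll.Birth.stub_principalSeriesCompatible

/-- The statement of `stub_supercuspidalCompatible`, as a named `Prop` (literally its type). [folklore] -/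
def stub_supercuspidalCompatible : Prop :=
  type_of% @Summit.Langlands.Langlands.Cruxes.NonAlignedAtEll.Birth.stub_supercuspidalCompatible

/-- The statement of `stub_specialMonodromy`, as a named `Prop` (literally its type). [folklore] -/
def stub_specialMonodromy : Prop :=
  type_of% @Summit.Langlands.Langlands.Cruxes.NonAlignedAtEll.Birth.stub_specialMonodromy

/-- The statement of `stub_specialCompatible`, as a named `Prop` (literally its type). [folklore] -/
def stub_specialCompatible : Prop :=
  type_of% @Summit.Langlands.Langlands.Cruxes.NonAlignedAtEll.Birth.stub_specialCompatible

end _Goal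

/-! ## 3. The composition (kernel-checked, no `sorry`): DE RHAM → matching by local type (PS | SC | N ≠ 0 → St) → the crux by name -/

/-- **`NonAlignedAtEll` from the five stubs.**  Fix the crux's context and a non-aligned `v ∣ ℓ`.
Stub 1 gives de Rhamness of `ρ|Γ_{K_v}` (second conjunct of the crux, and the standing hypothesis of
the matching stubs).  A local component `π_v` of `π` at `v` exists by Flath's theorem, PROVED in the
tree from Harish-Chandra's finiteness theorem (`exists_hasLocalComponentAt_of_isAdmissible`,
`automorphicRep_isAdmissible_holds`); with the representative `r₀ := (rec_v(π_v)).out`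
(`Quotient.out_eq`) split on `N(r₀) = 0` and on irreducibility of `r₀`: the supercuspidal and
principal-series stubs give `LocalGlobalCompatibleAt RD ι π ρ v` in the `N = 0` branches, and in the
special branch stub 4's `N_Gal ≠ 0` is the extra hypothesis of stub 5.  The hypotheses are, by name,
the statements of the five stubs; the conclusion is the route decl
`Summit.Langlands.Langlands.Theses.SenNullAlignment.NonAlignedAtEll`. [folklore] -/
theorem NonAlignedAtEll_of (hD : _Goal.stub_deRhamNonAligned)
    (hPS : _Goal.stub_principalSeriesCompatible) (hSC : _Goal.stub_supercuspidalCompatible)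
    (hN : _Goal.stub_specialMonodromy) (hSt : _Goal.stub_specialCompatible) :
    Summit.Langlands.Langlands.Theses.SenNullAlignment.NonAlignedAtEll := by
  -- the stub statements, as the Π-types they literally are
  have hD' : type_of% @stub_deRhamNonAligned := hD
  have hPS' : type_of% @stub_principalSeriesCompatible := hPS
  have hSC' : type_of% @stub_supercuspidalCompatible := hSC
  have hN' : type_of% @stub_specialMonodromy := hN
  have hSt' : type_of% @stub_specialCompatible := hSt
  intro K _ _ hK RD hreg hcpt π k w hL hhol hodd hne ℓ _ ι ρ hirr hae v hv hnal
  -- (1) de Rham at the non-aligned place `v` (stub 1)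
  have hdR : (RD.pst ℓ v hv).IsDeRhamFramed (ρ.toLocal v) :=
    hD' K hK RD hreg hcpt π k w hL hhol hodd hne ℓ ι ρ hirr hae v hv hnal
  refine ⟨?_, hdR⟩
  -- (2) a local component `π_v` of `π` at `v` (Flath; proved in the tree)
  obtain ⟨πv, hπv⟩ :=
    Literature.NumberTheory.Automorphic.AutomorphicRepData.exists_hasLocalComponentAt_of_isAdmissible
      (Literature.NumberTheory.Automorphic.automorphicRep_isAdmissible_holds hcpt) π.1 v
  -- (3) a Frobenius-semisimple representative `r₀` of `rec_v(π_v)` and the local trichotomy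
  have hout : Quotient.mk (Literature.NumberTheory.Automorphic.frobSemisimpleWDSetoid (v.adicCompletion K) 2)
      ((RD.llc v).recGL 2 (Literature.NumberTheory.Automorphic.IrrClass.mk πv)).out =
        (RD.llc v).recGL 2 (Literature.NumberTheory.Automorphic.IrrClass.mk πv) :=
    Quotient.out_eq _
  by_cases hN0 : ((RD.llc v).recGL 2 (Literature.NumberTheory.Automorphic.IrrClass.mk πv)).out.1.N = 0
  · by_cases hirrW :
        ((RD.llc v).recGL 2 (Literature.NumberTheory.Automorphic.IrrClass.mk πv)).out.1.IsIrreducible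
    · -- supercuspidal `π_v`
      exact hSC' K hK RD hreg hcpt π k w hL hhol hodd hne ℓ ι ρ hirr hae v hv hnal hdR πv _ hπv hout hN0
        hirrW
    · -- principal series `π_v`
      exact hPS' K hK RD hreg hcpt π k w hL hhol hodd hne ℓ ι ρ hirr hae v hv hnal hdR πv _ hπv hout hN0
        hirrW
  · -- special `π_v`: the monodromy statement (stub 4) feeds the matching (stub 5)
    exact hSt' K hK RD hreg hcpt π k w hL hhol hodd hne ℓ ι ρ hirr hae v hv hnal hdR πv _ hπv hout hN0
      (hN' K hK RD hreg hcpt π k w hL hhol hodd hne ℓ ι ρ hirr hae v hv hnal hdR πv _ hπv hout hN0)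

/-- By-name sanity check (an `example`, not a declaration of the file): the five stubs feed the
composition as they stand. -/
example : Summit.Langlands.Langlands.Theses.SenNullAlignment.NonAlignedAtEll :=
  NonAlignedAtEll_of stub_deRhamNonAligned stub_principalSeriesCompatible stub_supercuspidalCompatible
    stub_specialMonodromy stub_specialCompatible

end Summit.Langlands.Langlands.Cruxes.NonAlignedAtEll.Birth

end
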